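import Mathlib
import HarnessLib
import Summits.NavierStokesRegularity.NavierStokesRegularity.Theses.ThreadingFlux
import Summits.NavierStokesRegularity.NavierStokesRegularity.Theorems.ThreadingFluxConeStructurePotential
import Summits.NavierStokesRegularity.NavierStokesRegularity.Theorems.ThreadingFluxConeStructureRadialMean

/-!
# Route `ThreadingFlux`, support `ConeStructure` (stmt-NavierStokesRegularity-1221) — proved

The support item `ConeStructure` (card T1 «cone structure of a homogeneous trace» of route
ThreadingFlux): for `U` smooth on `ℝ³ ∖ {0}` and `(−1)`-homogeneous (`U(cx) = c⁻¹U(x)`, `c > 0`),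
with `ω = curl U`,

* (i) the radial part of `ω` has zero mean on the unit ball, `∫_{B₁} ⟨x, ω(x)⟩/‖x‖ dx = 0`
  (helper II, `integral_radialFlux_ball_eq_zero`: curl-free radial test fields, the tree's curl-by-parts
  identity, dominated convergence with `‖ω(x)‖ ≤ M‖x‖⁻²`);
* (ii) the tangential part of `ω` is a sphere-curl: `ω(x) − (⟨x,ω(x)⟩/‖x‖²) x = ‖x‖⁻² x × ∇χ(x)` off
  the origin for a `C¹`, `0`-homogeneous `χ` (helper I, `exists_sphereCurl_potential`, with the
  EXPLICIT potential `χ = −⟨x, U(x)⟩`: `x × curl U = (DU)ᵀx − DU·x` and Euler's relation `DU·x = −U`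
  give `x × curl U = ∇⟨x, U⟩` — no Hodge theory on `S²` is needed).

`threadingFlux_coneStructure_proof` is literally the route declaration. This closes a SUPPORT item of
route ThreadingFlux only; the route's cruxes (UnthreadedNoBlowup and its companions) stay open and
Navier–Stokes regularity is not proved by this file. No new definitions, no named facts.

## References

* A. J. Majda, A. L. Bertozzi, *Vorticity and Incompressible Flow* (CUP 2002), §1.1 (vector
  identities), §2.3 (homogeneous kernels). [MajdaBertozziCUP2002]
-/

noncomputable section

-- the summit and its single sub-problem share the name (CONVENTIONS §1), as in every Theorems file
set_option linter.dupNamespace false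

namespace Summit.NavierStokesRegularity.NavierStokesRegularity.Theorems

open Set Function Filter Topology Metric MeasureTheory
open scoped ContDiff RealInnerProductSpace
open Literature.Analysis.FluidPDE
open Summit.NavierStokesRegularity.NavierStokesRegularity.Theses

/-- **`ConeStructure` (stmt-NavierStokesRegularity-1221).** For `U` smooth on `ℝ³ ∖ {0}` and
`(−1)`-homogeneous: (i) `∫_{B₁} ⟨x, curl U(x)⟩/‖x‖ dx = 0`; (ii) there is a `C¹`, `0`-homogeneous
`χ` on `ℝ³ ∖ {0}` (explicitly `χ = −⟨x, U(x)⟩`) with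
`curl U(x) − (⟨x, curl U(x)⟩/‖x‖²) x = ‖x‖⁻² x × ∇χ(x)` for `x ≠ 0`.
[cite: MajdaBertozziCUP2002, §1.1 (vector identities), §2.3] -/
theorem threadingFlux_coneStructure_proof : ThreadingFlux.ConeStructure := by
  intro U hU hhom
  exact ⟨ConeStructure.integral_radialFlux_ball_eq_zero hU hhom,
    ConeStructure.exists_sphereCurl_potential hU hhom⟩

end Summit.NavierStokesRegularity.NavierStokesRegularity.Theorems
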